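import Summits.ResolutionOfSingularities.ResolutionOfSingularities.Theorems.FrobeniusClosingPatchingRelPerfectDepthOneDivisorialFactorization
import Literature.AlgebraicGeometry.Resolution.StrictNormalCrossingsHasSNC
import Literature.AlgebraicGeometry.Resolution.MonomialMarkedIdeals
import Literature.AlgebraicGeometry.Resolution.AlterationsBoundaryDivisor
import Literature.AlgebraicGeometry.Resolution.AlterationsMultisectionLocalStepProofs
import Literature.AlgebraicGeometry.Resolution.ArithmeticalThreefoldsBlowupFormDimThree
import HarnessLib

/-!
# Crux `PatchingRelPerfect` (stmt-ResolutionOfSingularities-16161), chain w52 — programme r-d1,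
# piece A2s `RegularizeSupport`: the END STATE (components of the support after Cossart–Jannsen–Saito)

[OURS · L1 W5.2 · rung tool] `ChainW52TargetsE.lean` (9d67ec503d849faa) l.425–446, target **A2s
`RegularizeSupport`** (CJS plumbing). This file proves its END-STATE half, free of the controlled-sequence
vocabulary: on a regular integral Noetherian scheme `Z₁` carrying a closed subset `X₁` whose reduced
structure `V(𝓘(X₁))` is a regular scheme and a strict normal crossings divisor `B₁` (the two end clauses
of the named fact `CossartJannsenSaito2020EmbeddedSequenceB`, F-32bR), every non-zero LOCALLY PRINCIPAL
ideal sheaf `𝔟'` with `Supp 𝔟' ⊆ X₁ ∪ B₁` has its support inside a finite union of closed sets `D` with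
`𝓘(D)` an effective Cartier divisor and `V(𝓘(D))` regular — namely the prime divisors `D = cl{ζ}`
through the codimension-one points `ζ` of `V(𝔟')`:

* `𝔟'` is an effective Cartier divisor (`IsLocallyPrincipal.isEffectiveCartier_of_ne_bot`), so every
  point of `V(𝔟')` specialises from a codimension-one point of `V(𝔟')` (Krull's Hauptidealsatz,
  `IsEffectiveCartier.exists_specializes_coheight_le_one`), of which there are finitely many
  (`finite_divisorialPoints`);
* each `𝓘(cl{ζ})` is Cartier on the regular `Z₁` (`isEffectiveCartier_primeDivisorIdeal_of_isRegular`,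
  Görtz–Wedhorn I, Thm. 11.40 (2));
* `ζ ∈ X₁`: `cl{ζ}` is an irreducible component of the proper closed set `closure X₁`
  (`DepthOne.closure_singleton_mem_componentsIn`, res-D-pv-059) and the components of the regular
  `V(𝓘(X₁))` carry its quotient stalks (`isRegular_subscheme_vanishingIdeal_piece`, Stacks 0357);
* `ζ ∈ B₁`: `ζ` is a maximal point of `B₁` (coheight count; `B₁ ≠ Z₁` since `𝓘(B₁)` is Cartier), so
  `𝓘(cl{ζ})` is a member of the simple-normal-crossings list of the components of `B₁`
  (`IsStrictNormalCrossingsDivisor.exists_hasSNC`, Stacks 0BIA) and `V(𝓘(cl{ζ}))` is regular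
  (`HasSNC.isRegular_subscheme_finsetSup`).

Transversality of `X₁` with `B₁` and purity of `X₁` are NOT used. Nothing here is a statement of the
manuscript under review.

## References

* V. Cossart, U. Jannsen, S. Saito, *Desingularization: Invariants and Strategy*, LNM 2270 (2020),
  Thm. 1.4 and Cor. 1.5 (the end state `X₁` regular, `B₁` snc). [CossartJannsenSaito2020]
* U. Görtz, T. Wedhorn, *Algebraic Geometry I*, 2nd ed. (2020), Thm. 11.40 (2). [GortzWedhorn2020]
* The Stacks Project, Tags 0357, 0BIA, 0BE1, 00KV. [StacksProject]
-/

-- `Summit.<Summit>.<Sub>.Theorems` with `Sub = Summit` (single-conjunct summit, D-0017)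
set_option linter.dupNamespace false

noncomputable section

open CategoryTheory AlgebraicGeometry TopologicalSpace Literature.AlgebraicGeometry.Resolution
open Scheme.IdealSheafData (vanishingIdeal)

namespace Summit.ResolutionOfSingularities.ResolutionOfSingularities.Theorems

namespace DepthOne

universe u

variable {E : Scheme.{u}}

/-- **The prime divisor through a codimension-one point of a regular `V(𝓘(D))` is regular** — variant
of `DepthOne.isRegular_subscheme_primeDivisorIdeal` asking only that the closed set `D` be PROPER (instead
of `𝓘(D)` Cartier): `cl{ζ}` is a component of `D`, and the components of the regular `V(𝓘(D))` are
pairwise disjoint, each carrying the quotient stalks of `V(𝓘(D))`. [cite: StacksProject, Tag 0357] -/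
theorem isRegular_subscheme_primeDivisorIdeal_of_ne_univ [IsIntegral E] [IsLocallyNoetherian E]
    [NoetherianSpace E] {D : Closeds E} (hDne : (D : Set E) ≠ Set.univ)
    (hDreg : Scheme.IsRegular (vanishingIdeal D).subscheme) {ζ : E} (hζ : Order.coheight ζ = 1)
    (hζD : ζ ∈ (D : Set E)) : Scheme.IsRegular (primeDivisorIdeal ζ).subscheme := by
  have hmem : (⟨closure {ζ}, isClosed_closure⟩ : Closeds E) ∈
      Kollar2007.boundaryPieces (vanishingIdeal D) := by
    rw [Kollar2007.mem_boundaryPieces_iff, Scheme.IdealSheafData.coe_support_vanishingIdeal]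
    exact closure_singleton_mem_componentsIn hζ D.isClosed hDne hζD
  exact isRegular_subscheme_vanishingIdeal_piece hDreg
    (isPiecePartition_boundaryPieces_of_isRegular hDreg) hmem

/-- **A codimension-one point of a strict normal crossings divisor is one of its maximal points** (on an
integral locally Noetherian scheme: `B ≠ Z₁` because `𝓘(B)` is an effective Cartier divisor, so every
point of `B` has codimension `≥ 1`). [cite: StacksProject, Tag 0BE1] -/
theorem mem_maxPoints_of_coheight_eq_one [IsIntegral E] [IsLocallyNoetherian E] {B : Set E}
    (hB : IsStrictNormalCrossingsDivisor E B) {ζ : E} (hζ : Order.coheight ζ = 1) (hζB : ζ ∈ B) :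
    ζ ∈ maxPoints B := by
  have hBne : ((⟨B, hB.isClosed⟩ : Closeds E) : Set E) ≠ Set.univ :=
    coe_ne_univ_of_isEffectiveCartier_vanishingIdeal hB.isEffectiveCartier_vanishingIdeal
  rw [mem_maxPoints_iff]
  refine ⟨hζB, fun η hη hηζ => ?_⟩
  have hη0 : Order.coheight η ≠ 0 := by
    intro h0
    apply hBne
    have hgen : genericPoint E ∈ B := eq_genericPoint_of_coheight_eq_zero h0 ▸ hη
    exact Set.eq_univ_of_univ_subset
      (((genericPoint_spec E).mem_closed_set_iff hB.isClosed).mp hgen)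
  refine eq_of_specializes_of_coheight_le hηζ (by rw [hζ]; exact ENat.coe_ne_top 1) ?_
  rw [hζ]
  exact Order.one_le_iff_ne_zero.mpr hη0

/-- **The components of a strict normal crossings divisor are regular** (Stacks 0BIA (2) ⇒ (1)): for a
codimension-one point `ζ` of an snc divisor `B` on a regular Noetherian integral scheme, the reduced
closed subscheme `V(𝓘(cl{ζ}))` is regular — `𝓘(cl{ζ})` is a member of the simple-normal-crossings list
of the component ideals of `B`. [cite: StacksProject, Tag 0BIA] -/
theorem isRegular_subscheme_primeDivisorIdeal_of_sncd [IsIntegral E] [IsNoetherian E]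
    (hE : Scheme.IsRegular E) {B : Set E} (hB : IsStrictNormalCrossingsDivisor E B) {ζ : E}
    (hζ : Order.coheight ζ = 1) (hζB : ζ ∈ B) : Scheme.IsRegular (primeDivisorIdeal ζ).subscheme := by
  obtain ⟨Es, hsnc, -, hmemEs, -⟩ := hB.exists_hasSNC hE
  have hmem := hmemEs ζ (mem_maxPoints_of_coheight_eq_one hB hζ hζB)
  have h := hsnc.isRegular_subscheme_finsetSup {primeDivisorIdeal ζ} (by
    intro K hK
    rw [Finset.mem_singleton] at hK
    rw [hK]
    exact hmem)
  rw [Finset.sup_singleton] at h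
  exact h

/-- **A2s `RegularizeSupport`, END STATE.** On a regular integral Noetherian scheme `Z₁` let `X₁` be a
subset whose closure has regular reduced structure `V(𝓘(X₁))` and does not contain the generic point,
`B₁` a strict normal crossings divisor, and `𝔟' ≠ 0` a locally principal ideal sheaf with
`Supp 𝔟' ⊆ X₁ ∪ B₁`. Then there is a finite set `s` of closed subsets `D` (the prime divisors through
the codimension-one points of `V(𝔟')`), each with `𝓘(D)` an effective Cartier divisor and `V(𝓘(D))`
regular, with `Supp 𝔟' ⊆ ⋃_{D ∈ s} D` — the last two clauses of `RegularizeSupport` for the end state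
of the named fact `CossartJannsenSaito2020EmbeddedSequenceB` (CJS 2020, Thm. 1.4 / Cor. 1.5).
[cite: CossartJannsenSaito2020, Thm. 1.4, Cor. 1.5] [cite: StacksProject, Tag 0BIA]
[cite: GortzWedhorn2020, Thm. 11.40 (2)] -/
theorem regularizeSupport_endState (Z₁ : Scheme.{u}) [IsIntegral Z₁] [IsNoetherian Z₁]
    (hZ₁ : Scheme.IsRegular Z₁) (X₁ B₁ : Set Z₁)
    (hX₁ : Scheme.IsRegular (vanishingIdeal ⟨closure X₁, isClosed_closure⟩).subscheme)
    (hB₁ : IsStrictNormalCrossingsDivisor Z₁ B₁) (hgen : genericPoint Z₁ ∉ closure X₁)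
    (𝔟' : Z₁.IdealSheafData) (h𝔟' : 𝔟' ≠ ⊥) (hlp : IsLocallyPrincipal 𝔟')
    (hsupp : (𝔟'.support : Set Z₁) ⊆ X₁ ∪ B₁) :
    ∃ s : Finset (Closeds Z₁),
      (∀ D ∈ s, IsEffectiveCartier (Scheme.IdealSheafData.vanishingIdeal D) ∧
        Scheme.IsRegular (Scheme.IdealSheafData.vanishingIdeal D).subscheme) ∧
      (𝔟'.support : Set Z₁) ⊆ ⋃ D ∈ s, (D : Set Z₁) := by
  classical
  have hcart : IsEffectiveCartier 𝔟' := hlp.isEffectiveCartier_of_ne_bot h𝔟'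
  have hfin : (divisorialPoints 𝔟').Finite := finite_divisorialPoints h𝔟'
  have hXne : ((⟨closure X₁, isClosed_closure⟩ : Closeds Z₁) : Set Z₁) ≠ Set.univ := by
    intro h
    exact hgen (by rw [show closure X₁ = Set.univ from h]; exact Set.mem_univ _)
  refine ⟨hfin.toFinset.image fun ζ => ⟨closure {ζ}, isClosed_closure⟩, ?_, ?_⟩
  · intro D hD
    obtain ⟨ζ, hζ, rfl⟩ := Finset.mem_image.mp hD
    rw [Set.Finite.mem_toFinset, mem_divisorialPoints_iff] at hζ
    obtain ⟨hζsupp, hζ1⟩ := hζ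
    refine ⟨isEffectiveCartier_primeDivisorIdeal_of_isRegular hZ₁ hζ1, ?_⟩
    rcases hsupp hζsupp with hζX | hζB
    · exact isRegular_subscheme_primeDivisorIdeal_of_ne_univ hXne hX₁ hζ1 (subset_closure hζX)
    · exact isRegular_subscheme_primeDivisorIdeal_of_sncd hZ₁ hB₁ hζ1 hζB
  · intro x hx
    obtain ⟨ξ, hξsupp, hξx, hξco⟩ := hcart.exists_specializes_coheight_le_one hx
    have hξ0 : Order.coheight ξ ≠ 0 := by
      intro h0
      exact not_mem_support_genericPoint h𝔟' (eq_genericPoint_of_coheight_eq_zero h0 ▸ hξsupp)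
    have hξ1 : Order.coheight ξ = 1 := le_antisymm hξco (Order.one_le_iff_ne_zero.mpr hξ0)
    refine Set.mem_iUnion₂.mpr ⟨⟨closure {ξ}, isClosed_closure⟩, ?_, ?_⟩
    · exact Finset.mem_image.mpr ⟨ξ, by
        rw [Set.Finite.mem_toFinset, mem_divisorialPoints_iff]; exact ⟨hξsupp, hξ1⟩, rfl⟩
    · exact specializes_iff_mem_closure.mp hξx

/-- **A2s `RegularizeSupport`, END STATE — consumer form over the CJS output.** For a morphism
`π : Z₁ ⟶ Z` (the composite of the CJS blowing ups) and a non-zero ideal sheaf `𝔟` on `Z` whose total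
transform `𝔟𝒪_{Z₁} ≠ 0` divides into the end ideal `𝔟'` (`𝔟𝒪_{Z₁} ≤ 𝔟'`, as for every controlled
transform), with `π⁻¹(Supp 𝔟) = X₁ ∪ B₁` (CJS 2020, p. 7: "`π₁⁻¹(X) = X₁ ∪ B₁`"), `V(𝓘(X₁))` regular and
`B₁` a strict normal crossings divisor on the regular integral Noetherian `Z₁`: the support of the
non-zero locally principal `𝔟'` lies in a finite union of closed sets `D` with `𝓘(D)` an effective
Cartier divisor and `V(𝓘(D))` regular. [cite: CossartJannsenSaito2020, Thm. 1.4, Cor. 1.5 (p. 7)] -/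
theorem regularizeSupport_endState_of_preimage {Z₁ Z : Scheme.{u}} [IsIntegral Z₁] [IsNoetherian Z₁]
    (hZ₁ : Scheme.IsRegular Z₁) (π : Z₁ ⟶ Z) (𝔟 : Z.IdealSheafData) (hne : 𝔟.comap π ≠ ⊥)
    (X₁ B₁ : Set Z₁) (htot : π ⁻¹' (𝔟.support : Set Z) = X₁ ∪ B₁)
    (hX₁ : Scheme.IsRegular (vanishingIdeal ⟨closure X₁, isClosed_closure⟩).subscheme)
    (hB₁ : IsStrictNormalCrossingsDivisor Z₁ B₁)
    (𝔟' : Z₁.IdealSheafData) (h𝔟' : 𝔟' ≠ ⊥) (hlp : IsLocallyPrincipal 𝔟') (hle : 𝔟.comap π ≤ 𝔟') :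
    ∃ s : Finset (Closeds Z₁),
      (∀ D ∈ s, IsEffectiveCartier (Scheme.IdealSheafData.vanishingIdeal D) ∧
        Scheme.IsRegular (Scheme.IdealSheafData.vanishingIdeal D).subscheme) ∧
      (𝔟'.support : Set Z₁) ⊆ ⋃ D ∈ s, (D : Set Z₁) := by
  -- `Supp 𝔟' ⊆ Supp (𝔟𝒪_{Z₁}) = π⁻¹(Supp 𝔟) = X₁ ∪ B₁`
  have hpre : ((𝔟.comap π).support : Set Z₁) = X₁ ∪ B₁ := by
    rw [Scheme.IdealSheafData.support_comap, TopologicalSpace.Closeds.coe_preimage]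
    exact htot
  have hsupp : (𝔟'.support : Set Z₁) ⊆ X₁ ∪ B₁ := fun x hx =>
    hpre ▸ (Scheme.IdealSheafData.support_antitone hle hx : x ∈ ((𝔟.comap π).support : Set Z₁))
  -- the generic point is off `closure X₁ ⊆ X₁ ∪ B₁ = Supp (𝔟𝒪_{Z₁})`
  have hclosed : IsClosed (X₁ ∪ B₁) := hpre ▸ (𝔟.comap π).support.isClosed
  have hgen : genericPoint Z₁ ∉ closure X₁ := by
    intro h
    have h' : genericPoint Z₁ ∈ ((𝔟.comap π).support : Set Z₁) := by
      rw [hpre]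
      exact closure_minimal Set.subset_union_left hclosed h
    exact not_mem_support_genericPoint hne h'
  exact regularizeSupport_endState Z₁ hZ₁ X₁ B₁ hX₁ hB₁ hgen 𝔟' h𝔟' hlp hsupp

end DepthOne

end Summit.ResolutionOfSingularities.ResolutionOfSingularities.Theorems

end
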